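import Literature.NumberTheory.EllipticCurves.ShaCorestrictionIndexTwo
import Literature.NumberTheory.EllipticCurves.CasselsTateOmegaBalanced
import HarnessLib

/-!
# The Cassels–Tate pairing: restriction and corestriction along a QUADRATIC field are ADJOINT
# (Fisher 2003, Prop. 2.16) — ONE named fact over the tree's `cor`, and its two `j = 0` consequences
# `B_K(res a, res b) = 2·B_ℚ(a, b)`, `B_K(res a, w·res b) = −B_ℚ(a, b)` for the TAIL of crux 19804

Topic `NumberTheory/EllipticCurves`, family `bsd`. Vocabulary: `ShaCorestrictionIndexTwo.lean` (file A of the same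
seat: `corBaseChange K W σ₀ h2 hσ₀ : H¹(K, E_K) → H¹(ℚ, E)` for `[K : ℚ] = 2`, `cor ∘ res = 2`, `res ∘ cor = 1 + σ_*`),
`CasselsTatePairingFunctorial.lean` (the one-field named fact `casselsTate_pairing_functorial F`: THE family of
pairings on the `Ш(W/F)`, alternating, left kernel = divisible subgroup, adjoint along dual isogeny pairs — Milne
*ADT* I 6.9/6.10(a)/6.13(a)), `CasselsTateOmegaBalanced.lean` (p693884: `CasselsTateOmega.apply_w_eq_apply_w_w`, the
`𝒪`-balanced law for ANY family with the adjointness clause), `ShaRestriction.lean` (`shaRestriction`,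
`resBaseChange`), `SelmerPInftyGaloisAction.lean` / `ShaRestrictionJZeroDescent.lean` (`IsLiftOfAut.conjH1Points`,
`conjH1Points_shaRestriction`).  ONE NAMED FACT (`def … : Prop`, D-0014; net debt +1, planner D568 (α2) file B,
recorded on filing) + THEOREMS; no instance, no notation, no `sorry`.  Seat `bsd-cm-k-ty1` (tenth seating); helper of
crux `stmt-BirchSwinnertonDyer-19804` (`UpperOffV0HSYPlus`), rows k-p2 (TAIL = THEOREM K3/K3*: the base-changed
Lagrangian step, cell memo two §59.1 (iii) / §64.5 SET-UP; rows' flag k7t-c2 g27 2026-08-29 «(W-d) IS load-bearing»).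
No summit statement is proved or advanced by this file alone; nothing about the ORDER of `Ш` is asserted; BSD is not
claimed.

## THE PRINT

T. A. Fisher, *The Cassels–Tate pairing and the Platonic solids*, J. Number Theory 98 (2003) 105–155, Proposition 2.16
(p. 132): «Let `L/K` be a finite extension of number fields. Let `E/K` be an elliptic curve. Then the restriction map
`Ш(E/K) → Ш(E/L)` and the corestriction map `Ш(E/L) → Ш(E/K)` are adjoints with respect to the Cassels–Tate pairing.»
[corpus: paper:doi-10-1016-s0022-314x-02-00038-0 p28 L9–11; proof L12–30: homogeneous-space definition of the pairing,
«corestriction is the map on cohomology corresponding to the norm in dimension 0», `Cor ∘ Res = n` on `Br`].  Modern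
field-change form: A. Morgan, A. Smith, *Field change for the Cassels–Tate pairing and applications to class groups*,
Res. Number Theory (2024) = arXiv:2206.13403, Thm. 1.1.  The one-field clauses: Milne, *ADT* I Prop. 6.9, Rem. 6.10(a)
(p. 79), Thm. 6.13(a) [corpus: paper:url-620c8c980f6e p87].

## HOW IT IS TYPED (planner D568 conditions (i)–(iv))

(i) ONE existential over the PAIR of families `(Bℚ, BK)` — `Bℚ` on the `Ш(W/ℚ)`, `BK` on the `Ш(V/K)` — carrying the
functorial clauses (alternating, kernel, dual-isogeny adjointness) for BOTH fields AND the adjoint clause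
`BK (W.baseChange K) (shaRestriction W K a) c = Bℚ W a ⟨cor c, hc⟩`, so every consumer reads (WRAP-CT), LEMMA D and
(CT-3) off the SAME `BK` (projections `casselsTate_pairing_functorial_rat_of_resCor` / `…_of_resCor` PROVED).
(ii) Weaker than print in exactly one point: the membership `cor c ∈ Ш(E/ℚ)` is the binder `hc`
(`-- TODO(general form): cor(Ш(E_K/K)) ⊆ Ш(E/ℚ)` for every `E`, and `[L : K] > 2`); for `j = 0` short models over
`K ∋ ζ₃` the consequences below need `hc` only for `c = res b` (`corBaseChange_shaRestriction_mem`, any `E`) and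
`c = w · res b` (where `cor c = −b` by `res ∘ cor = 1 + σ_*`, `σ_* w = w̄ σ_*`, `σ_* res = res` and injectivity of
`res` on `H¹(ℚ, E)` — `JZero.resBaseChange_injective_of_isPrimitiveRoot`).  (iii) PROVED in-file: the projections, the
restriction of the two families to the `2`-primary parts with alternating / antisymmetric / trivial-kernel clauses
(the argument of `CasselsTateOmegaBalanced.lean` §1, private here), the `𝒪`-balanced law for THIS `BK`
(`CasselsTateOmega.apply_w_eq_apply_w_w`), and the two consequences (§4 at the level of `Ш`, §5 packaged on
`Ш[2^∞]` in the binder currency of `SylvesterTwoShaConjugation.exists_lemmaD_data`).  (iv) Fisher's sentence is quoted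
verbatim above and in the fact's docstring.

## WHAT IS FORMALISED

* §1 ★ `casselsTate_pairing_resCor (K) (σ₀ : K ≃ₐ[ℚ] K) (h2 : Module.finrank ℚ K = 2) (hσ₀ : σ₀ ≠ 1) : Prop` — THE FACT.
* §2 `casselsTate_pairing_functorial_rat_of_resCor`, `casselsTate_pairing_functorial_of_resCor` (projections).
* §3 private algebra (`exists_restrict_two_primary` & co.).
* §4 ★ `apply_shaRestriction_shaRestriction_of_adjoint` (`BK _ (res a) (res b) = 2 • Bℚ W a b`, any `E`),
  ★ `apply_shaRestriction_of_add_conj_eq_of_adjoint` (`BK _ (res a) c = -(Bℚ W a b)` when `c + σ_* c = res (−b)` and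
  `res` is injective) — both for ANY pair of families with the adjoint clause.
* §5 ★ `exists_casselsTate_resCor_package (hRC) (W) [W.IsElliptic] [(W.baseChange K).IsElliptic] (φ) (w) (hw) (hwrel)
  (hτ : IsLiftOfAut σ₀ τ) (s) (hs) (hsw) (hinj : Function.Injective (resBaseChange W K))` :
  `∃ Bℚ₂ B₂ res₂`, `res₂` = `shaRestriction` on `Ш[2^∞]`; `Bℚ₂`, `B₂` alternating, antisymmetric, kernels trivial
  under `Finite`; `B₂ (w a) b = B₂ a (w (w b)) = B₂ a (-b - w b)`; `B₂ (res₂ a) (res₂ b) = 2 • Bℚ₂ a b`;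
  `B₂ (res₂ a) (w (res₂ b)) = -(Bℚ₂ a b)`.

RECIPE (rows): with `exists_lemmaD_data`'s `⟨φ, w, s, hw, hs, hwrel, hss, hsw, h3⟩` and
`hinj := JZero.resBaseChange_injective_of_isPrimitiveRoot W K ha₁ ha₂ ha₃ ha₄ h2 hζ hσζ`, one call of
`exists_casselsTate_resCor_package hRC W φ w hw hwrel hτ s hs hsw hinj` gives `(Bℚ₂, B₂, res₂)`; a `Bℚ₂`-Lagrangian
`D₀⁰` of `Ш(W/ℚ)[2^∞]` (`Literature.GroupTheory.FiniteAbelian.SymplecticModules.exists_lagrangian_sq_eq_card`) gives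
`D₀ := res₂ '' D₀⁰ ≤ S` with `h00`/`h0w` of `…UnramifiedQuadraticPairings.isotropic_sup_map_w` and `#D₀² = #S`
(`JZero.shaRestriction_injective`, `JZero.range_shaRestriction_eq`).  NOT HERE: that assembly (rows, Summits side).

## References

* T. A. Fisher, J. Number Theory 98 (2003) 105–155, Prop. 2.16. [Fisher2003]
* J. S. Milne, *Arithmetic Duality Theorems*, 2nd ed. (2006), I Prop. 6.9, Rem. 6.10(a), Thm. 6.13(a). [MilneADT2006]
* A. Morgan, A. Smith, arXiv:2206.13403 (Res. Number Theory 2024), Thm. 1.1 (modern form; not a bib key here).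
* Cell: memo two v2.21 §59.1 (iii), §64.5; planner D560 (W-d), D567 (3), D568 (α2); SPEC-K-TY § (CT-3).
-/

set_option autoImplicit false

noncomputable section

open scoped Classical

namespace Literature.NumberTheory.EllipticCurves

open GaloisRepresentations WeierstrassCurve

/-! ## §1 The named fact -/

/-- **Cassels–Tate pairing: restriction and corestriction are adjoint (Fisher 2003, Prop. 2.16),
quadratic case, over the tree's corestriction.**  T. A. Fisher, *The Cassels–Tate pairing and the
Platonic solids*, J. Number Theory 98 (2003), Proposition 2.16 (p. 132): «Let `L/K` be a finite
extension of number fields. Let `E/K` be an elliptic curve. Then the restriction map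
`Ш(E/K) → Ш(E/L)` and the corestriction map `Ш(E/L) → Ш(E/K)` are adjoints with respect to the
Cassels–Tate pairing.» (modern field-change form: Morgan–Smith, arXiv:2206.13403, Thm. 1.1).
Typed for the base `ℚ`, a QUADRATIC number field `K` (`[K : ℚ] = 2`, `σ₀ ≠ 1`), and THE
Cassels–Tate pairing FAMILIES over `ℚ` and over `K` in ONE existential — each family carrying the
clauses of `casselsTate_pairing_functorial` (alternating, left kernel = divisible subgroup, adjoint
along dual isogeny pairs: Milne, *ADT* I Prop. 6.9, Rem. 6.10(a), Thm. 6.13(a)) — plus the ADJOINT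
CLAUSE `B_K(res a, c) = B_ℚ(a, cor c)` for the tree's `res = shaRestriction W K` and
`cor = corBaseChange K W σ₀ h2 hσ₀` (`ShaCorestrictionIndexTwo.lean`).  Weaker than print in ONE
point only: the membership `cor c ∈ Ш(E/ℚ)` is carried as the binder `hc`
-- TODO(general form): cor(Ш(E_K/K)) ⊆ Ш(E/ℚ) for every E (local double-coset compatibility), and [L : K] > 2.
[cite: Fisher2003, Prop. 2.16] [cite: MilneADT2006, I Prop. 6.9, Rem. 6.10(a), Thm. 6.13(a)] -/
def casselsTate_pairing_resCor (K : Type) [Field K] [NumberField K] (σ₀ : K ≃ₐ[ℚ] K)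
    (h2 : Module.finrank ℚ K = 2) (hσ₀ : σ₀ ≠ 1) : Prop :=
  ∃ (Bℚ : (W : WeierstrassCurve ℚ) → (W.sha →+ W.sha →+ AddCircle (1 : ℚ)))
    (BK : (V : WeierstrassCurve K) → (V.sha →+ V.sha →+ AddCircle (1 : ℚ))),
    ((∀ (W : WeierstrassCurve ℚ) [W.IsElliptic],
        (∀ x, Bℚ W x x = 0) ∧ ∀ x, (∀ y, Bℚ W x y = 0) ↔ x ∈ AddSubgroup.divisibleElements W.sha) ∧
      ∀ (W W' : WeierstrassCurve ℚ) [W.IsElliptic] [W'.IsElliptic] (φ : Isogeny W W')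
        (ψ : Isogeny W' W), (∀ P, ψ (φ P) = (φ.degree : ℤ) • P) →
        ∀ (x : W.sha) (y : W'.sha),
          Bℚ W' (shaMap φ.toAddMonoidHom φ.map_smul φ.hasLocalPointsMaps_toAddMonoidHom x) y =
            Bℚ W x (shaMap ψ.toAddMonoidHom ψ.map_smul ψ.hasLocalPointsMaps_toAddMonoidHom y)) ∧
    ((∀ (V : WeierstrassCurve K) [V.IsElliptic],
        (∀ x, BK V x x = 0) ∧ ∀ x, (∀ y, BK V x y = 0) ↔ x ∈ AddSubgroup.divisibleElements V.sha) ∧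
      ∀ (V V' : WeierstrassCurve K) [V.IsElliptic] [V'.IsElliptic] (φ : Isogeny V V')
        (ψ : Isogeny V' V), (∀ P, ψ (φ P) = (φ.degree : ℤ) • P) →
        ∀ (x : V.sha) (y : V'.sha),
          BK V' (shaMap φ.toAddMonoidHom φ.map_smul φ.hasLocalPointsMaps_toAddMonoidHom x) y =
            BK V x (shaMap ψ.toAddMonoidHom ψ.map_smul ψ.hasLocalPointsMaps_toAddMonoidHom y)) ∧
    ∀ (W : WeierstrassCurve ℚ) [W.IsElliptic] (a : W.sha) (c : (W.baseChange K).sha)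
      (hc : corBaseChange K W σ₀ h2 hσ₀ (c : (W.baseChange K).galH1) ∈ W.sha),
      BK (W.baseChange K) (shaRestriction W K a) c = Bℚ W a ⟨_, hc⟩

/-! ## §2 Projections to the one-field functorial facts -/

section Projections

variable {K : Type} [Field K] [NumberField K] {σ₀ : K ≃ₐ[ℚ] K} {h2 : Module.finrank ℚ K = 2}
  {hσ₀ : σ₀ ≠ 1}

/-- The fact implies `casselsTate_pairing_functorial ℚ` (first family). [cite: MilneADT2006, I Prop. 6.9, Rem. 6.10(a), Thm. 6.13(a)] -/
theorem casselsTate_pairing_functorial_rat_of_resCor (h : casselsTate_pairing_resCor K σ₀ h2 hσ₀) :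
    casselsTate_pairing_functorial ℚ := by
  obtain ⟨Bℚ, -, hℚ, -, -⟩ := h
  exact ⟨Bℚ, hℚ.1, hℚ.2⟩

/-- The fact implies `casselsTate_pairing_functorial K` (second family). [cite: MilneADT2006, I Prop. 6.9, Rem. 6.10(a), Thm. 6.13(a)] -/
theorem casselsTate_pairing_functorial_of_resCor (h : casselsTate_pairing_resCor K σ₀ h2 hσ₀) :
    casselsTate_pairing_functorial K := by
  obtain ⟨-, BK, -, hK, -⟩ := h
  exact ⟨BK, hK.1, hK.2⟩

end Projections

/-! ## §3 Algebra helpers (private) -/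

section Algebra

variable {Q : Type*} [AddCommGroup Q]

/-- An element killed by two coprime natural numbers is zero. [folklore] -/
private theorem eq_zero_of_nsmul_eq_zero_of_coprime' {v : Q} {m n : ℕ} (hmn : Nat.Coprime m n)
    (hm : m • v = 0) (hn : n • v = 0) : v = 0 :=
  AddMonoid.addOrderOf_eq_one_iff.mp (Nat.eq_one_of_dvd_coprimes hmn
    (addOrderOf_dvd_of_nsmul_eq_zero hm) (addOrderOf_dvd_of_nsmul_eq_zero hn))

/-- A biadditive alternating pairing is antisymmetric. [folklore] -/
private theorem antisymm_of_alternating' {M : Type*} [AddCommGroup M] (B : M →+ M →+ Q)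
    (halt : ∀ x, B x x = 0) (a b : M) : B b a = -(B a b) := by
  have h := halt (a + b)
  rw [map_add, map_add B a b, AddMonoidHom.add_apply, AddMonoidHom.add_apply, halt a, halt b,
    zero_add, add_zero] at h
  exact eq_neg_of_add_eq_zero_left h

variable {G : Type*} [AddCommGroup G]

/-- An odd multiple of any element of a torsion group is `2`-primary. [folklore] -/
private theorem exists_odd_nsmul_mem_primaryComponent_two' (htors : AddMonoid.IsTorsion G) (y : G) :
    ∃ m : ℕ, Odd m ∧ m • y ∈ AddCommGroup.primaryComponent G 2 := by
  obtain ⟨e, m, hm, hn⟩ := Nat.exists_eq_two_pow_mul_odd (htors y).addOrderOf_pos.ne'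
  refine ⟨m, hm, (AddCommGroup.mem_primaryComponent (G := G)).mpr ⟨e, ?_⟩⟩
  rw [← mul_nsmul', ← hn]
  exact addOrderOf_nsmul_eq_zero y

/-- Left kernel on a finite `2`-primary component of a torsion group from «kernel ⊆ divisible»
(the argument of `CasselsTateOmegaBalanced.lean` §1). [folklore] -/
private theorem eq_zero_of_forall_apply_primaryComponent_eq_zero' (htors : AddMonoid.IsTorsion G)
    (B : G →+ G →+ Q) (hker : ∀ x, (∀ y, B x y = 0) → x ∈ AddSubgroup.divisibleElements G)
    [Finite (AddCommGroup.primaryComponent G 2)] {a : G}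
    (ha : a ∈ AddCommGroup.primaryComponent G 2)
    (horth : ∀ y ∈ AddCommGroup.primaryComponent G 2, B a y = 0) : a = 0 := by
  obtain ⟨k, hk⟩ := (AddCommGroup.mem_primaryComponent (G := G)).mp ha
  have hleft : ∀ y, B a y = 0 := fun y ↦ by
    obtain ⟨m, hm, hmy⟩ := exists_odd_nsmul_mem_primaryComponent_two' htors y
    have h1 : m • B a y = 0 := by rw [← map_nsmul]; exact horth _ hmy
    have h2 : 2 ^ k • B a y = 0 := by
      rw [← AddMonoidHom.nsmul_apply, ← map_nsmul, hk, map_zero, AddMonoidHom.zero_apply]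
    exact eq_zero_of_nsmul_eq_zero_of_coprime' (hm.coprime_two_left.pow_left k) h2 h1
  obtain ⟨z, hz⟩ := (AddSubgroup.mem_divisibleElements_iff _ a).mp (hker a hleft) _
    (Nat.card_pos (α := AddCommGroup.primaryComponent G 2))
  obtain ⟨m, hm, hmz⟩ := exists_odd_nsmul_mem_primaryComponent_two' htors z
  have hNz : Nat.card (AddCommGroup.primaryComponent G 2) • (m • z) = 0 := by
    have h := addOrderOf_dvd_natCard (⟨m • z, hmz⟩ : AddCommGroup.primaryComponent G 2)
    rw [addOrderOf_dvd_iff_nsmul_eq_zero] at h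
    have h' := congrArg Subtype.val h
    rw [AddSubmonoidClass.coe_nsmul, ZeroMemClass.coe_zero] at h'
    exact h'
  have hma : m • a = 0 := by rw [← hz, ← mul_nsmul', mul_comm, mul_nsmul', hNz]
  exact eq_zero_of_nsmul_eq_zero_of_coprime' (hm.coprime_two_left.pow_left k) hk hma

/-- Restricting a family component to the `2`-primary part: alternating, antisymmetric, and with
trivial kernels when that part is finite (given clause (i) and torsion). [folklore] -/
private theorem exists_restrict_two_primary (htors : AddMonoid.IsTorsion G) (B : G →+ G →+ Q)
    (halt : ∀ x, B x x = 0) (hker : ∀ x, (∀ y, B x y = 0) → x ∈ AddSubgroup.divisibleElements G) :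
    ∃ B₂ : AddCommGroup.primaryComponent G 2 →+ AddCommGroup.primaryComponent G 2 →+ Q,
      (∀ a b, B₂ a b = B a b) ∧ (∀ a, B₂ a a = 0) ∧ (∀ a b, B₂ b a = -(B₂ a b)) ∧
      (Finite (AddCommGroup.primaryComponent G 2) →
        (∀ a, (∀ b, B₂ a b = 0) → a = 0) ∧ (∀ b, (∀ a, B₂ a b = 0) → b = 0)) := by
  let H := AddCommGroup.primaryComponent G 2
  let B₂ : H →+ H →+ Q := (B.comp H.subtype).compl₂ H.subtype
  have hB₂ : ∀ a b : H, B₂ a b = B (a : G) (b : G) := fun a b ↦ rfl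
  have halt₂ : ∀ a : H, B₂ a a = 0 := fun a ↦ by rw [hB₂]; exact halt _
  have hanti₂ := antisymm_of_alternating' B₂ halt₂
  refine ⟨B₂, hB₂, halt₂, hanti₂, fun hfin ↦ ⟨fun a ha ↦ ?_, fun b hb ↦ ?_⟩⟩
  · exact Subtype.ext (eq_zero_of_forall_apply_primaryComponent_eq_zero' htors B hker a.2
      fun y hy ↦ by have := ha ⟨y, hy⟩; rwa [hB₂] at this)
  · exact Subtype.ext (eq_zero_of_forall_apply_primaryComponent_eq_zero' htors B hker b.2
      fun y hy ↦ by have := hb ⟨y, hy⟩; rwa [hanti₂, hB₂, neg_eq_zero] at this)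

end Algebra

/-! ## §4 The two consequences of the adjointness at the level of `Ш` -/

section Consequences

variable {K : Type} [Field K] [NumberField K] {σ₀ : K ≃ₐ[ℚ] K} {h2 : Module.finrank ℚ K = 2}
  {hσ₀ : σ₀ ≠ 1}
  {Bℚ : (W : WeierstrassCurve ℚ) → (W.sha →+ W.sha →+ AddCircle (1 : ℚ))}
  {BK : (V : WeierstrassCurve K) → (V.sha →+ V.sha →+ AddCircle (1 : ℚ))}

/-- **`B_K(res a, res b) = 2 · B_ℚ(a, b)`** (adjointness + `cor ∘ res = 2`; Fisher 2003 Prop. 2.16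
with Serre I.§2.4 Prop. 9). [cite: Fisher2003, Prop. 2.16] -/
theorem apply_shaRestriction_shaRestriction_of_adjoint
    (hadj : ∀ (W : WeierstrassCurve ℚ) [W.IsElliptic] (a : W.sha) (c : (W.baseChange K).sha)
      (hc : corBaseChange K W σ₀ h2 hσ₀ (c : (W.baseChange K).galH1) ∈ W.sha),
      BK (W.baseChange K) (shaRestriction W K a) c = Bℚ W a ⟨_, hc⟩)
    (W : WeierstrassCurve ℚ) [W.IsElliptic] (a b : W.sha) :
    BK (W.baseChange K) (shaRestriction W K a) (shaRestriction W K b) = 2 • Bℚ W a b := by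
  have hmem := corBaseChange_shaRestriction_mem K W σ₀ h2 hσ₀ b
  have e2 : (⟨_, hmem⟩ : W.sha) = 2 • b :=
    Subtype.ext (corBaseChange_shaRestriction K W σ₀ h2 hσ₀ b)
  rw [hadj W a _ hmem, e2, map_nsmul]

/-- **`B_K(res a, c) = −B_ℚ(a, b)` whenever `c + σ_* c = res (−b)`** in `H¹(K, E_K)` and `res` is
injective on `H¹(ℚ, E)` (then `cor c = −b` by `res ∘ cor = 1 + σ_*`): the shape in which the
`(WRAP-𝒪)/(WRAP-σ)` data produce `c = w · res b`. [cite: Fisher2003, Prop. 2.16] -/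
theorem apply_shaRestriction_of_add_conj_eq_of_adjoint
    (hadj : ∀ (W : WeierstrassCurve ℚ) [W.IsElliptic] (a : W.sha) (c : (W.baseChange K).sha)
      (hc : corBaseChange K W σ₀ h2 hσ₀ (c : (W.baseChange K).galH1) ∈ W.sha),
      BK (W.baseChange K) (shaRestriction W K a) c = Bℚ W a ⟨_, hc⟩)
    (W : WeierstrassCurve ℚ) [W.IsElliptic] (hinj : Function.Injective (resBaseChange W K))
    {τ : AlgebraicClosure K ≃+* AlgebraicClosure K} (hτ : IsLiftOfAut σ₀ τ) (a b : W.sha)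
    (c : (W.baseChange K).sha)
    (hc : (c : (W.baseChange K).galH1) + hτ.conjH1Points W (c : (W.baseChange K).galH1) =
      resBaseChange W K ((-b : W.sha) : W.galH1)) :
    BK (W.baseChange K) (shaRestriction W K a) c = -(Bℚ W a b) := by
  have hcor : corBaseChange K W σ₀ h2 hσ₀ (c : (W.baseChange K).galH1) = ((-b : W.sha) : W.galH1) :=
    hinj (by rw [resBaseChange_corBaseChange K W σ₀ h2 hσ₀ hτ, hc])
  have hmem : corBaseChange K W σ₀ h2 hσ₀ (c : (W.baseChange K).galH1) ∈ W.sha := by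
    rw [hcor]; exact (-b).2
  have e2 : (⟨_, hmem⟩ : W.sha) = -b := Subtype.ext hcor
  rw [hadj W a c hmem, e2, map_neg]

end Consequences

/-! ## §5 The package consumed by the TAIL: (WRAP-CT) for the fact's OWN `K`-family, the
`ℚ`-side pairing, and the two `j = 0` consequences -/

section Package

variable {K : Type} [Field K] [NumberField K] {σ₀ : K ≃ₐ[ℚ] K} {h2 : Module.finrank ℚ K = 2}
  {hσ₀ : σ₀ ≠ 1}

set_option maxHeartbeats 400000 in
/-- **The (CT-3) package.** From `casselsTate_pairing_resCor K σ₀ h2 hσ₀` (displayed as `hRC`), for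
an elliptic `W/ℚ` with `W_K` elliptic, the (WRAP-𝒪) data `(φ, w, hw, hwrel)` on `Ш(W_K/K)[2^∞]`
(`SylvesterTwoShaConjugation.exists_lemmaD_data`'s binders, `H¹`-level `hw`), the (WRAP-σ) data
`(s, hs, hsw)` for a lift `τ` of `σ₀` (same source), and injectivity of `resBaseChange W K` on
`H¹(ℚ, E)` (for `j = 0` short models over `K ∋ ζ₃`: `JZero.resBaseChange_injective_of_isPrimitiveRoot`):
there are the restrictions `Bℚ₂` of THE `ℚ`-pairing to `Ш(W/ℚ)[2^∞]`, `B₂` of THE `K`-pairing to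
`Ш(W_K/K)[2^∞]`, and the restriction `res₂` of `shaRestriction W K` to the `2`-primary parts, with:
`Bℚ₂`, `B₂` alternating, antisymmetric, with trivial kernels when the respective `2`-primary part is
finite; `B₂` `𝒪`-BALANCED (`B₂ (w a) b = B₂ a (-b - w b)`, both spellings;
`CasselsTateOmega.apply_w_eq_apply_w_w`); and the two consequences of Fisher's adjointness with
`cor ∘ res = 2`, `res ∘ cor = 1 + σ_*` (`ShaCorestrictionIndexTwo.lean`):
`B₂ (res₂ a) (res₂ b) = 2 • Bℚ₂ a b` and `B₂ (res₂ a) (w (res₂ b)) = -(Bℚ₂ a b)` — the input of the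
base-changed Lagrangian step (§D of the cell's `…UnramifiedQuadraticPairings.lean`: for a
`Bℚ₂`-isotropic `D₀⁰`, `D₀ := res₂ D₀⁰` has `B₂(D₀, D₀) = B₂(D₀, w D₀) = 0`).
[cite: Fisher2003, Prop. 2.16] [cite: MilneADT2006, I Prop. 6.9, Rem. 6.10(a), Thm. 6.13(a)] -/
theorem exists_casselsTate_resCor_package (hRC : casselsTate_pairing_resCor K σ₀ h2 hσ₀)
    (W : WeierstrassCurve ℚ) [W.IsElliptic] [(W.baseChange K).IsElliptic]
    (φ : Isogeny (W.baseChange K) (W.baseChange K))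
    (w : AddCommGroup.primaryComponent (W.baseChange K).sha 2 →+
      AddCommGroup.primaryComponent (W.baseChange K).sha 2)
    (hw : ∀ x, (((w x : AddCommGroup.primaryComponent (W.baseChange K).sha 2) :
        (W.baseChange K).sha) : (W.baseChange K).galH1) =
      galH1Map φ.toAddMonoidHom φ.equivariant ((x : (W.baseChange K).sha) : (W.baseChange K).galH1))
    (hwrel : ∀ x, w (w x) + w x + x = 0)
    {τ : AlgebraicClosure K ≃+* AlgebraicClosure K} (hτ : IsLiftOfAut σ₀ τ)
    (s : AddCommGroup.primaryComponent (W.baseChange K).sha 2 →+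
      AddCommGroup.primaryComponent (W.baseChange K).sha 2)
    (hs : ∀ x, (((s x : AddCommGroup.primaryComponent (W.baseChange K).sha 2) :
        (W.baseChange K).sha) : (W.baseChange K).galH1) =
      hτ.conjH1Points W ((x : (W.baseChange K).sha) : (W.baseChange K).galH1))
    (hsw : ∀ x, s (w x) = -(s x) - w (s x))
    (hinj : Function.Injective (resBaseChange W K)) :
    ∃ (Bℚ₂ : AddCommGroup.primaryComponent W.sha 2 →+ AddCommGroup.primaryComponent W.sha 2 →+
        AddCircle (1 : ℚ))
      (B₂ : AddCommGroup.primaryComponent (W.baseChange K).sha 2 →+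
        AddCommGroup.primaryComponent (W.baseChange K).sha 2 →+ AddCircle (1 : ℚ))
      (res₂ : AddCommGroup.primaryComponent W.sha 2 →+
        AddCommGroup.primaryComponent (W.baseChange K).sha 2),
      (∀ a, ((res₂ a : AddCommGroup.primaryComponent (W.baseChange K).sha 2) :
        (W.baseChange K).sha) = shaRestriction W K a) ∧
      ((∀ a, Bℚ₂ a a = 0) ∧ (∀ a b, Bℚ₂ b a = -(Bℚ₂ a b)) ∧
        (Finite (AddCommGroup.primaryComponent W.sha 2) →
          (∀ a, (∀ b, Bℚ₂ a b = 0) → a = 0) ∧ (∀ b, (∀ a, Bℚ₂ a b = 0) → b = 0))) ∧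
      ((∀ a, B₂ a a = 0) ∧ (∀ a b, B₂ b a = -(B₂ a b)) ∧
        (∀ a b, B₂ (w a) b = B₂ a (w (w b))) ∧ (∀ a b, B₂ (w a) b = B₂ a (-b - w b)) ∧
        (Finite (AddCommGroup.primaryComponent (W.baseChange K).sha 2) →
          (∀ a, (∀ b, B₂ a b = 0) → a = 0) ∧ (∀ b, (∀ a, B₂ a b = 0) → b = 0))) ∧
      (∀ a b, B₂ (res₂ a) (res₂ b) = 2 • Bℚ₂ a b) ∧
      (∀ a b, B₂ (res₂ a) (w (res₂ b)) = -(Bℚ₂ a b)) := by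
  obtain ⟨Bℚ, BK, ⟨hℚi, hℚii⟩, ⟨hKi, hKii⟩, hadj⟩ := hRC
  -- the two restricted pairings
  obtain ⟨Bℚ₂, hBℚ₂, hℚalt, hℚanti, hℚnd⟩ := exists_restrict_two_primary
    (WeierstrassCurve.isTorsion_sha W) (Bℚ W) (hℚi W).1 (fun x hx ↦ ((hℚi W).2 x).mp hx)
  obtain ⟨B₂, hB₂, hKalt, hKanti, hKnd⟩ := exists_restrict_two_primary
    (WeierstrassCurve.isTorsion_sha (W.baseChange K)) (BK (W.baseChange K)) (hKi _).1
    (fun x hx ↦ ((hKi _).2 x).mp hx)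
  -- the restriction on the 2-primary parts
  have hresmem : ∀ a : AddCommGroup.primaryComponent W.sha 2,
      shaRestriction W K a ∈ AddCommGroup.primaryComponent (W.baseChange K).sha 2 := fun a ↦ by
    obtain ⟨k, hk⟩ := (AddCommGroup.mem_primaryComponent (G := W.sha)).mp a.2
    exact (AddCommGroup.mem_primaryComponent (G := (W.baseChange K).sha)).mpr
      ⟨k, by rw [← map_nsmul, hk, map_zero]⟩
  obtain ⟨res₂, hres₂⟩ : ∃ res₂ : AddCommGroup.primaryComponent W.sha 2 →+
      AddCommGroup.primaryComponent (W.baseChange K).sha 2,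
      ∀ a, ((res₂ a : AddCommGroup.primaryComponent (W.baseChange K).sha 2) :
        (W.baseChange K).sha) = shaRestriction W K a :=
    ⟨((shaRestriction W K).comp (AddCommGroup.primaryComponent W.sha 2).subtype).codRestrict _
      fun a ↦ hresmem a, fun _ ↦ rfl⟩
  -- Ш-level form of `hw`, and the 𝒪-balancedness for THIS family
  have hw' : ∀ x, ((w x : AddCommGroup.primaryComponent (W.baseChange K).sha 2) :
      (W.baseChange K).sha) =
      shaMap φ.toAddMonoidHom φ.equivariant φ.hasLocalPointsMaps_toAddMonoidHom x := fun x ↦ by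
    apply Subtype.ext
    rw [hw, coe_shaMap_apply]
  have hbal : ∀ a b : AddCommGroup.primaryComponent (W.baseChange K).sha 2,
      B₂ (w a) b = B₂ a (w (w b)) := fun a b ↦ by
    rw [hB₂, hB₂]
    exact CasselsTateOmega.apply_w_eq_apply_w_w hKii φ w hw' hwrel a b
  have hww : ∀ x : AddCommGroup.primaryComponent (W.baseChange K).sha 2, w (w x) = -x - w x :=
    fun x ↦ by
    have h := hwrel x
    rw [add_assoc] at h
    rw [eq_neg_of_add_eq_zero_left h]
    abel
  -- consequence 1
  have hc1 : ∀ a b : AddCommGroup.primaryComponent W.sha 2, B₂ (res₂ a) (res₂ b) = 2 • Bℚ₂ a b :=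
    fun a b ↦ by
    rw [hB₂, hres₂, hres₂, apply_shaRestriction_shaRestriction_of_adjoint hadj W, hBℚ₂]
  -- consequence 2: `c = w (res b)` satisfies `c + σ_* c = res (−b)`
  have hc2 : ∀ a b : AddCommGroup.primaryComponent W.sha 2,
      B₂ (res₂ a) (w (res₂ b)) = -(Bℚ₂ a b) := fun a b ↦ by
    have hsres : s (res₂ b) = res₂ b := by
      apply Subtype.ext; apply Subtype.ext
      rw [hs, hres₂, conjH1Points_shaRestriction]
    have key : w (res₂ b) + s (w (res₂ b)) = -(res₂ b) := by rw [hsw, hsres]; abel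
    have key' := congrArg (fun z : AddCommGroup.primaryComponent (W.baseChange K).sha 2 ↦
      ((z : (W.baseChange K).sha) : (W.baseChange K).galH1)) key
    simp only [AddMemClass.coe_add, NegMemClass.coe_neg] at key'
    rw [hs (w (res₂ b)), hres₂, coe_shaRestriction_apply, ← map_neg] at key'
    have hc := apply_shaRestriction_of_add_conj_eq_of_adjoint hadj W hinj hτ (a : W.sha) (b : W.sha)
      ((w (res₂ b) : AddCommGroup.primaryComponent (W.baseChange K).sha 2) : (W.baseChange K).sha)
      (by rw [key', NegMemClass.coe_neg])
    rw [hB₂, hres₂, hc, hBℚ₂]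
  exact ⟨Bℚ₂, B₂, res₂, hres₂, ⟨hℚalt, hℚanti, hℚnd⟩,
    ⟨hKalt, hKanti, hbal, fun a b ↦ by rw [hbal, hww], hKnd⟩, hc1, hc2⟩

end Package

end Literature.NumberTheory.EllipticCurves

end
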